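import Literature.MathematicalPhysics.QuantumLattice.TypeClassSidecarReader
import Literature.MathematicalPhysics.QuantumLattice.TorusSectorPressureTypeBoundAllTori
import HarnessLib

/-!
# Kernel reader for «c2-sector» sidecars along ALL tori: temperature-axis energy windows for every torus limit

Family `hubbard` (topic `MathematicalPhysics/QuantumLattice`). `TypeClassSidecarReader.lean` reads a checked «c2-sector»
sidecar (`c2Check … = true` + its claim node) into the pressure-floor hypothesis of the temperature-axis windows along
BOX-COMPATIBLE tori (`Ls j = K_x a = K_y b`, …). `TorusSectorPressureTypeBoundAllTori.lean` (hubbard-downfold-unc-2) removed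
that restriction: the type-class floor `∀ ε > 0, ∀ᶠ j, (W − ε)(Ls j)² ≤ log Z_β^{sector}(Ls j)` holds along EVERY `Ls → ∞` as
soon as the base type has the right density, `n · (q a b) = 2 A₀` (two-scale tiling with a corner patch absorbing the
particle-number remainder). This file combines the two: the reader theorems
`IsTorusLimitOfMixture.meanEnergy_hubbardTTPrime_le_of_c2Check_of_rectMarkovCertificate_allTori` (upper edge from the sidecar
at `β` + a C1 rectangle certificate at `β_h < β`) and `…le_meanEnergy_hubbardTTPrime_of_c2Check_of_rectMarkovCertificate_allTori`
(lower edge, C1 at `β_c > β`) for EVERY torus limit of the canonical sector Gibbs states — the object of the programme's rows —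
with hypotheses: the Boolean check, the claim node, the density identity, and the C1 matrix certificate; nothing else.
[cite: Ruelle1969, §3.3] [cite: CoverThomas2006, Theorem 11.1.3] [cite: Israel1979, Lemma II.3.1]
[cite: PoulinHastings2011, eqs. (3)–(8)]. Everything is PROVED; no definition, no named fact.
-/

noncomputable section

namespace Literature.MathematicalPhysics.QuantumLattice

open Matrix Finset HubbardWave0 ThermodynamicLimit LiebThm1 AndersonCluster Literature.Probability.LatticeModels
open _root_.Filter
open scoped _root_.Topology ComplexOrder BigOperators

namespace InfVolFermionState

variable {t U n β : ℝ} {ω : InfVolFermionState 2} {Ls : ℕ → ℕ}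

/-- **Upper edge along EVERY sequence of tori from a checked «c2-sector» sidecar at `β` and a C1 rectangle certificate at
`β_h < β`.** `ω` a torus limit of the canonical sector Gibbs states at `β` along any `Ls → ∞` (`0 ≤ n ≤ 2`); sidecar `rows`
for the open `a × b` box passing `c2Check P K q A₀ a b rows Wnum Wden` with density `n (q a b) = 2 A₀` and its CLAIM NODE
`∀ r ∈ rows, zn_r/2^ze_r ≤ Re Z_β(H^open_{a×b}; N↑_r, N↓_r)`; C1 data on `rectWindow a' b'` at `(β_h, μ)` with constant `c`.
Then `e_Φ(ω) ≤ ((c − β_h μ n) − Wnum/Wden)/(β − β_h)`.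
[cite: Israel1979, Lemma II.3.1] [cite: PoulinHastings2011, eqs. (3)–(8)] [cite: Ruelle1969, §3.3] -/
theorem IsTorusLimitOfMixture.meanEnergy_hubbardTTPrime_le_of_c2Check_of_rectMarkovCertificate_allTori
    (hn0 : 0 ≤ n) (hn2 : n ≤ 2)
    (h : ω.IsTorusLimitOfMixture (sectorGibbsCount n) (fun L => sectorGibbsWeightTT' β t 0 U n L)
      (fun L => sectorGibbsVectorTT' t 0 U n L) Ls)
    (hLs : Tendsto Ls atTop atTop) {βh : ℝ} (hβh : 0 < βh) (hlt : βh < β)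
    -- C2 sidecar at `β`
    {a b : ℕ} (ha : 1 ≤ a) (hb : 1 ≤ b) {rows : List C2Row} {P K q A₀ : ℕ} {Wnum : ℤ} {Wden : ℕ}
    (hcheck : c2Check P K q A₀ a b rows Wnum Wden = true) (hn : n * ((q : ℝ) * a * b) = 2 * A₀)
    (hnode : ∀ r ∈ rows, r.floor ≤ (partitionFn β (spinSectorHamiltonian r.nu r.nd (hubbardOpenBoxTT' a b t 0 U))).re)
    -- C1 at `βh`
    (μ : ℝ) {a' b' : ℕ} (ha' : 2 ≤ a') (hb' : 2 ≤ b')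
    {ι : Type*} (sι : Finset ι) (Sw : ι → Finset (Site 2)) (hS : ∀ i, Sw i ⊆ rectWindow a' b') (zw : ι → Site 2)
    (hzw : ∀ i, shiftSet (zw i) (Sw i) ⊆ rectWindow a' b') {O : ∀ i, FermionOp (Sw i)}
    (hO : ∀ i ∈ sι, (O i).IsHermitian) (g : ι → ℝ)
    {LB : FermionOp ((rectWindow a' b').erase (mkSite2 (a' - 1) (b' - 1)))} (hLB : LB.IsHermitian) {c : ℝ}
    (hcert : ((Real.exp c : ℂ) • cfc Real.exp LB -
      fermionPartialTrace (PolySite.incl (Finset.erase_subset (mkSite2 (a' - 1) (b' - 1)) (rectWindow a' b')))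
        (cfc Real.exp (-((βh : ℂ) • (cornerEnergyRep (rectWindow a' b') (mkSite2 (a' - 1) (b' - 1)) t U μ +
            windowAnnihilator sι (rectWindow a' b') Sw hS zw hzw O g)) +
          fermionEmbed (PolySite.incl (Finset.erase_subset (mkSite2 (a' - 1) (b' - 1)) (rectWindow a' b'))) LB))).PosSemidef) :
    ω.meanEnergy (hubbardTTPrimeFermionInteraction t 0 U) 1 ≤ ((c - βh * μ * n) - (Wnum : ℝ) / Wden) / (β - βh) := by
  obtain ⟨hnd, hq, hmS, hsum, hA, hB, hz0, harith⟩ := c2Check_sound hcheck ha hb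
  have hz := c2Floor_le_of_rows hnd
    (F := fun s => (partitionFn β (spinSectorHamiltonian s.1 s.2 (hubbardOpenBoxTT' a b t 0 U))).re)
    (fun r hr => hnode r hr)
  have hβ : 0 ≤ β := (hβh.trans hlt).le
  have hKTI : ∀ (L : ℕ) [NeZero L], ∀ w : TorusSite 2 L,
      relabel (Orb.translate w) (hubbardTorusTT' L t 0 U - (μ : ℂ) • totalNumber) =
        hubbardTorusTT' L t 0 U - (μ : ℂ) • totalNumber := fun L _ w => by
    rw [hubbardTorusTT'_zero_sub_mu, relabel_translate_hubbardTorusWith]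
  have hmain := h.meanEnergy_hubbardTTPrime_le_of_eventually_pressure_bounds hn0 hn2 hLs hβh hlt
    (fun ε hε => eventually_typeFreeEntropy_mul_sq_le_log_partitionFn_allTori t 0 U n hβ ha hb
      (c2Sectors rows) (c2Type rows) hq hmS hsum hA hB hn hn2 hz0 hz hLs hε)
    (fun ε hε => eventually_log_partitionFn_sectorHamiltonianTT'_le_of_clusterCertificate t U μ βh hn0 hn2 hLs
      (rectCorner_mem_rectWindow (by omega) (by omega)) toLex_le_toLex_rectCorner
      (rectWindow_subset_halfOpenBox_max a' b')
      (fun i => bondWeightSum_cornerBondWeight (rectCorner_mem_rectWindow (by omega) (by omega))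
        (rectCorner_sub_unitVec_mem_rectWindow ha' hb' i))
      (siteWeightSum_cornerSiteWeight (rectCorner_mem_rectWindow (by omega) (by omega)))
      (siteWeightSum_mul_cornerSiteWeight (rectCorner_mem_rectWindow (by omega) (by omega)) (-μ))
      (isHermitian_windowAnnihilator sι _ Sw hS zw hzw hO g)
      (fun L _ hL3 hℓL => trace_window_mul_windowAnnihilator (relabel_translate_gibbsDensity L (hKTI L) βh)
        _ sι Sw hS zw hzw O g) hLB hcert hε)
  refine hmain.trans (div_le_div_of_nonneg_right ?_ (by linarith))
  linarith

/-- **Lower edge along EVERY sequence of tori from a checked «c2-sector» sidecar at `β` and a C1 rectangle certificate at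
`β_c > β`** (same data, C1 at `(β_c, μ)`): `(Wnum/Wden − (c − β_c μ n))/(β_c − β) ≤ e_Φ(ω)`.
[cite: Israel1979, Lemma II.3.1] [cite: PoulinHastings2011, eqs. (3)–(8)] [cite: Ruelle1969, §3.3] -/
theorem IsTorusLimitOfMixture.le_meanEnergy_hubbardTTPrime_of_c2Check_of_rectMarkovCertificate_allTori
    (hn0 : 0 ≤ n) (hn2 : n ≤ 2)
    (h : ω.IsTorusLimitOfMixture (sectorGibbsCount n) (fun L => sectorGibbsWeightTT' β t 0 U n L)
      (fun L => sectorGibbsVectorTT' t 0 U n L) Ls)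
    (hLs : Tendsto Ls atTop atTop) (hβ : 0 < β) {βc : ℝ} (hlt : β < βc)
    -- C2 sidecar at `β`
    {a b : ℕ} (ha : 1 ≤ a) (hb : 1 ≤ b) {rows : List C2Row} {P K q A₀ : ℕ} {Wnum : ℤ} {Wden : ℕ}
    (hcheck : c2Check P K q A₀ a b rows Wnum Wden = true) (hn : n * ((q : ℝ) * a * b) = 2 * A₀)
    (hnode : ∀ r ∈ rows, r.floor ≤ (partitionFn β (spinSectorHamiltonian r.nu r.nd (hubbardOpenBoxTT' a b t 0 U))).re)
    -- C1 at `βc`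
    (μ : ℝ) {a' b' : ℕ} (ha' : 2 ≤ a') (hb' : 2 ≤ b')
    {ι : Type*} (sι : Finset ι) (Sw : ι → Finset (Site 2)) (hS : ∀ i, Sw i ⊆ rectWindow a' b') (zw : ι → Site 2)
    (hzw : ∀ i, shiftSet (zw i) (Sw i) ⊆ rectWindow a' b') {O : ∀ i, FermionOp (Sw i)}
    (hO : ∀ i ∈ sι, (O i).IsHermitian) (g : ι → ℝ)
    {LB : FermionOp ((rectWindow a' b').erase (mkSite2 (a' - 1) (b' - 1)))} (hLB : LB.IsHermitian) {c : ℝ}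
    (hcert : ((Real.exp c : ℂ) • cfc Real.exp LB -
      fermionPartialTrace (PolySite.incl (Finset.erase_subset (mkSite2 (a' - 1) (b' - 1)) (rectWindow a' b')))
        (cfc Real.exp (-((βc : ℂ) • (cornerEnergyRep (rectWindow a' b') (mkSite2 (a' - 1) (b' - 1)) t U μ +
            windowAnnihilator sι (rectWindow a' b') Sw hS zw hzw O g)) +
          fermionEmbed (PolySite.incl (Finset.erase_subset (mkSite2 (a' - 1) (b' - 1)) (rectWindow a' b'))) LB))).PosSemidef) :
    ((Wnum : ℝ) / Wden - (c - βc * μ * n)) / (βc - β) ≤ ω.meanEnergy (hubbardTTPrimeFermionInteraction t 0 U) 1 := by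
  obtain ⟨hnd, hq, hmS, hsum, hA, hB, hz0, harith⟩ := c2Check_sound hcheck ha hb
  have hz := c2Floor_le_of_rows hnd
    (F := fun s => (partitionFn β (spinSectorHamiltonian s.1 s.2 (hubbardOpenBoxTT' a b t 0 U))).re)
    (fun r hr => hnode r hr)
  have hKTI : ∀ (L : ℕ) [NeZero L], ∀ w : TorusSite 2 L,
      relabel (Orb.translate w) (hubbardTorusTT' L t 0 U - (μ : ℂ) • totalNumber) =
        hubbardTorusTT' L t 0 U - (μ : ℂ) • totalNumber := fun L _ w => by
    rw [hubbardTorusTT'_zero_sub_mu, relabel_translate_hubbardTorusWith]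
  have hmain := h.le_meanEnergy_hubbardTTPrime_of_eventually_pressure_bounds hn0 hn2 hLs hβ hlt
    (fun ε hε => eventually_typeFreeEntropy_mul_sq_le_log_partitionFn_allTori t 0 U n hβ.le ha hb
      (c2Sectors rows) (c2Type rows) hq hmS hsum hA hB hn hn2 hz0 hz hLs hε)
    (fun ε hε => eventually_log_partitionFn_sectorHamiltonianTT'_le_of_clusterCertificate t U μ βc hn0 hn2 hLs
      (rectCorner_mem_rectWindow (by omega) (by omega)) toLex_le_toLex_rectCorner
      (rectWindow_subset_halfOpenBox_max a' b')
      (fun i => bondWeightSum_cornerBondWeight (rectCorner_mem_rectWindow (by omega) (by omega))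
        (rectCorner_sub_unitVec_mem_rectWindow ha' hb' i))
      (siteWeightSum_cornerSiteWeight (rectCorner_mem_rectWindow (by omega) (by omega)))
      (siteWeightSum_mul_cornerSiteWeight (rectCorner_mem_rectWindow (by omega) (by omega)) (-μ))
      (isHermitian_windowAnnihilator sι _ Sw hS zw hzw hO g)
      (fun L _ hL3 hℓL => trace_window_mul_windowAnnihilator (relabel_translate_gibbsDensity L (hKTI L) βc)
        _ sι Sw hS zw hzw O g) hLB hcert hε)
  refine le_trans (div_le_div_of_nonneg_right ?_ (by linarith)) hmain
  linarith

/-- **Transfer along the temperature axis for ALL tori** (the `P ≡ True` case of `TypeClassSidecarReader` §6): an upper edge valid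
for every torus limit at `β₁ > 0` along every `Ls → ∞` holds for every torus limit at every `β ≥ β₁`. [cite: Ruelle1969, §2.5–2.6] -/
theorem IsTorusLimitOfMixture.meanEnergy_hubbardTTPrime_le_of_forall_at_hotter_allTori {t' : ℝ} (hn0 : 0 ≤ n) (hn2 : n ≤ 2)
    {β₁ β hi : ℝ} (hβ₁ : 0 < β₁) (hle : β₁ ≤ β)
    (hcap : ∀ (ω₁ : InfVolFermionState 2) (Ls : ℕ → ℕ), Tendsto Ls atTop atTop →
      ω₁.IsTorusLimitOfMixture (sectorGibbsCount n) (fun L => sectorGibbsWeightTT' β₁ t t' U n L)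
        (fun L => sectorGibbsVectorTT' t t' U n L) Ls →
      ω₁.meanEnergy (hubbardTTPrimeFermionInteraction t t' U) 1 ≤ hi)
    {ω : InfVolFermionState 2} {Ls : ℕ → ℕ} (hLs : Tendsto Ls atTop atTop)
    (h : ω.IsTorusLimitOfMixture (sectorGibbsCount n) (fun L => sectorGibbsWeightTT' β t t' U n L)
      (fun L => sectorGibbsVectorTT' t t' U n L) Ls) :
    ω.meanEnergy (hubbardTTPrimeFermionInteraction t t' U) 1 ≤ hi :=
  IsTorusLimitOfMixture.meanEnergy_hubbardTTPrime_le_of_forall_at_hotter hn0 hn2 (P := fun _ => True)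
    (fun _ _ _ _ => trivial) hβ₁ hle (fun ω₁ Ls hLs _ h₁ => hcap ω₁ Ls hLs h₁) hLs trivial h

/-- **Transfer of a lower edge for ALL tori**: a lower edge valid for every torus limit at `β₂` along every `Ls → ∞` holds for
every torus limit at every `0 < β ≤ β₂`. [cite: Ruelle1969, §2.5–2.6] -/
theorem IsTorusLimitOfMixture.le_meanEnergy_hubbardTTPrime_of_forall_at_colder_allTori {t' : ℝ} (hn0 : 0 ≤ n) (hn2 : n ≤ 2)
    {β₂ β lo : ℝ} (hβ : 0 < β) (hle : β ≤ β₂)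
    (hfloor : ∀ (ω₂ : InfVolFermionState 2) (Ls : ℕ → ℕ), Tendsto Ls atTop atTop →
      ω₂.IsTorusLimitOfMixture (sectorGibbsCount n) (fun L => sectorGibbsWeightTT' β₂ t t' U n L)
        (fun L => sectorGibbsVectorTT' t t' U n L) Ls →
      lo ≤ ω₂.meanEnergy (hubbardTTPrimeFermionInteraction t t' U) 1)
    {ω : InfVolFermionState 2} {Ls : ℕ → ℕ} (hLs : Tendsto Ls atTop atTop)
    (h : ω.IsTorusLimitOfMixture (sectorGibbsCount n) (fun L => sectorGibbsWeightTT' β t t' U n L)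
      (fun L => sectorGibbsVectorTT' t t' U n L) Ls) :
    lo ≤ ω.meanEnergy (hubbardTTPrimeFermionInteraction t t' U) 1 :=
  IsTorusLimitOfMixture.le_meanEnergy_hubbardTTPrime_of_forall_at_colder hn0 hn2 (P := fun _ => True)
    (fun _ _ _ _ => trivial) hβ hle (fun ω₂ Ls hLs _ h₂ => hfloor ω₂ Ls hLs h₂) hLs trivial h

end InfVolFermionState

end Literature.MathematicalPhysics.QuantumLattice

end
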